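import Literature.MathematicalPhysics.QuantumFieldTheory.Balaban1983to89.B2Eq265Restrictions255
import Literature.MathematicalPhysics.QuantumFieldTheory.Balaban1983to89.B2Lemma23HiggsLattice

/-!
# `Balaban1983to89.B2Eq265From260` — [Balaban1982Higgs2] Lemma 2.4 (2.65) p.572 on the (Higgs)₂,₃ carrier of record with the regularity
# of the background `A^{(k)}` taken BY NAME from Lemma 2.3 (2.60) p.571 (r14's `B2Lemma23HiggsLattice.lemma23_higgsLattice`, the cut-off
# minimizer (3.3)/(2.54) `A^{(k)} = a_kζ^{(k)}G_kQ_k^*A` = `cutMin`): the proof's sentence p.572 (AS PRINTED, render re-read by the row owner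
# r02 2026-08-23) «From the property (2.60) we have the inequality |A^{(k)}(x) − A^{(k)}(y)| ≦ O(p(Lᵏε)r(Lᵏε)).» — so the small-gradient
# size `δA` of F7–F9 is no longer read by the user but FED by Lemma 2.3's explicit (2.60) bound (`eq265_higgs_region_from260`)

statement-level skeleton of published theorems with citation tags; proofs where landed; nothing here is a claim
about the Yang–Mills mass gap

PDF held: `paper:balaban1982-cmp86-higgs23-ii` (journal page = PDF page + 554), p. 571 [PDF 17] (Lemma 2.3 (2.59)–(2.60), text layer p0017
L8–11; «The inequality (2.60) implies that the configuration A^{(k)} considered on the set Bᵏ(Λ₂^{(k−1)′}) satisfies the assumption of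
Proposition I.2.1. on a vector field configuration.» L27–29), p. 572 [PDF 18] (Lemma 2.4 and «From the property (2.60) …», L1–4, L12–14),
p. 569 [PDF 15] ((2.54) «A^{(k)} = a_kζ^{(k)}G_kQ_k^*A»).

CITATION HEADER (lean-in-tree rule).  T. Bałaban, *(Higgs)₂,₃ quantum fields in a finite volume. II. An upper bound*,
Commun. Math. Phys. **86** (1982) 555–594, doi:10.1007/bf01214890 [Balaban1982Higgs2].  Cell `lit-balaban` (HOME
`run/shared/lean/pub/lit-balaban/`), Phase-2 proof seat **p23** gen 22 (unit `lit-balaban-p23-g22`; free-target protocol G.5-34(d), TAKING #2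
line HOME/STATUS.md 2026-08-23); SKELETON row **B2.Lem2.4** (fold owner r02, second reader r14; head `proved p250408 · …` UNCHANGED —
cells-only member, brick F10; the «by-name bridge from B2.Lem2.3's (2.60)» named by the owner r02 g48), consuming row **B2.Lem2.3**'s member
`B2Lemma23HiggsLattice` (r14 g11) BY NAME.  USED BY NAME, never restated: own F9 `B2Eq265Restrictions255.eq265_higgs_region_restr255`, r14's
`B2Lemma23HiggsLattice.{cutMin, lemma23_higgsLattice}`, p38/p14's torus sub-family `B1Eq211ZeroFieldTorus.Shape`, the typer's
`B3MultiscaleFields.{toSite, ofSite}` (vector fields as `ℝ^d`-valued site functions, part I p.608 «N = d … A = 0»), `B2Eq255Concrete.Restr255`.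

THE ARGUMENT.  Lemma 2.4's background field is (2.54) `A^{(k)} = a_kζ^{(k)}G_kQ_k^*A` for the vector field `A` of the step (the field
restricted by (2.55)₁,₂); on the carrier this is r14's `cutMin C₀ μ₀² a_V k ζ (toSite A′)` (an `ℝ^d`-valued function on `T_η`), i.e. the
bond field `ofSite (cutMin …)`.  Lemma 2.3 (2.60) in r14's explicit form gives, for every `z ∈ Bᵏ(Λ₂)` and direction `ν`,
`‖A^{(k)}(z + e_ν) − A^{(k)}(z)‖ ≤ L^{−k}(C_V(r₁ + r₂)q_V + C_F e^{−δρ₁}t_V)` under its own hypotheses (the printed properties (2.44) of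
`ζ^{(k)}`, (2.55)₁,₂ in the integrated reading on `Λ₋₁ ⊇ Λ₂`, the torus sub-family); a coordinate of an `ℝ^d`-vector is bounded by its
norm, so F9's small-gradient hypothesis `|A_{⟨z+e_ν,μ⟩} − A_{⟨z,μ⟩}| ≤ δA` on `Bᵏ(Λ₂)` HOLDS for every `δA ≥` that bound
(`grad_ofSite_cutMin_le`), and F9 applies to `A^{(k)} := ofSite (cutMin …)`.

WHAT THIS FILE PROVES (kernel-checked, zero `sorry`; theorems only — NO definition, NO `Prop`-valued fact; axioms standard).
 §1 `abs_ofSite_sub_le` (a bond-component difference is bounded by the `ℝ^d`-norm difference), **`grad_ofSite_cutMin_le`** (F9's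
    gradient hypothesis on `Bᵏ(Λ₂)` for `ofSite (cutMin …)` from an `ℝ^d`-norm (2.60)-type bound).
 §2 **`eq265_higgs_region_from260`** — (2.65) value clause on the carrier: F9's `eq265_higgs_region_restr255` word for word except (located
    edits): `hL : Odd L ∧ 1 < L` (the sub-family's) for `2 ≤ L`; new leading binders `a_V, μ₀² > 0` (the vector-field propagator's constants)
    and prefix `∃ δ C_V C_F > 0` (Lemma 2.3's constants, functions of `d, L, a_V, μ₀², ε₀`); `∀ P` gains `Shape P`; the binders
    `(A : VecField P 0) {δA}, 0 ≤ δA → (|∂A| ≤ δA on Bᵏ(Λ₂)) →` are REPLACED by Lemma 2.3's data and hypotheses verbatim — `Λ₋₁ ⊇ Λ₂`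
    (moved here from the `φ`-block, where `Λ₆ ⊆ Λ₋₁` is now derived), the cutoff `ζ` with `ρ, ρ₁` and the four printed properties (2.44),
    the neighbourhood condition `x_k ∈ Λ₂ → |x_k − y′| ≤ ρ + 1 → y′ ∈ Λ₋₁`, a charge datum `C₀` on `ℝ^d`, the step's vector field `A′`
    with `t_V ≥ 0, q_V ≥ 0, r₁ ≥ 0, r₂ ≥ 0` and (2.55)₁,₂ integrated on `Λ₋₁` for `toSite A′` — plus `{δA}` with the single hypothesis
    `L^{−k}(C_V(r₁+r₂)q_V + C_F e^{−δρ₁}t_V) ≤ δA`; and `A ↦ ofSite (cutMin C₀ μ₀² a_V k ζ (toSite A′))` at its three occurrences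
    (`bgScalar256 … A φ x`, `avgQkAdj C A k φ x`, `Restr255 … φ A`).  The seven-term bound is F9's, unchanged.

HONEST SCOPE / DIFFERENCES FROM PRINT (recorded, not hidden; one sentence each).  (a) TORUS SUB-FAMILY — A NARROWING OF THE FAMILY
RELATIVE TO F9: Lemma 2.3 on the carrier is r14's theorem for the tori `M·L′_μ = Lᵐ`, `L` odd, `1 ≤ k ≤ K`, `Lᵏε ≤ ε₀` (`Shape`, p14's
zero-field decay bounds underneath), so THIS (2.65) value clause holds on the sub-family `Shape P` with `Odd L ∧ 1 < L` on top of F9's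
`K₀ ∣ M` (F9's `1 ≤ k ≤ K`, `Lᵏε ≤ ε₀`, `Lᵏε ≤ 1` were already hypotheses; non-vacuous: `K₀`, `M`, `L′_μ` powers of `L`) — row B2.Lem2.3's
own scope of record, carried; F9 (all `P`, `δA` and `A` free binders) stays the general member.  (a′) `A^{(k)}` is NO LONGER A FREE BINDER:
it is the minimizer `ofSite (cutMin C₀ μ₀² a_V k ζ (toSite A′))` of the step field `A′`; Lemma 2.3's letters `t_V, q_V, r₁, r₂, ρ, ρ₁` and
the `ζ` data are free (READINGS against (2.55)₁,₂/(2.44)/(2.7) are the user's); `Λ₆ ⊆ Λ₋₁` is dropped because it follows from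
`Λ₆ ⊆ Λ₂ ⊆ Λ₋₁`; nothing is minted (`δ, C_V, C_F` are Lemma 2.3's existential constants, `K₀min … D₄` F9's).  (b) (2.60)'s SIZE is r14's explicit
`L^{−k}(C_V(r₁+r₂)q_V + C_F e^{−δρ₁}t_V)`, homogeneous in the abstract thresholds `t_V, q_V, r₁, r₂` of the integrated reading of (2.55)₁,₂
(row B2.Lem2.3's HONEST SCOPE (ii): `t_V ↤ c₁p/(μ₀L^{k−1}ε)`, `q_V(r₁ + r₂|y − y′|)` the variation modulus; the conversion to print's
`O(p(Lᵏε))` via `rDecayBeatsPowers` is that row's) — conjuncts 1–2 of `Restr255` are NOT converted into it here (both are hypotheses on the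
same `A′`).  (c) ZERO EXTERNAL FIELD in `G_k`, `Q_k^*` of (2.54) (part I p.608 — the vector-field case IS the zero-field case) with its own
constants `a_V, μ₀²` and any charge datum `C₀` on `ℝ^d` (immaterial at zero field).  (d) The two printed SMALLNESS scalings stay hypotheses on
`δA` (`LᵏδA|e| ≤ t`, `Lᵏ(Lᵏε)|e|δA ≤ c_reg e_k^β`), now readable as conditions on `e(Lᵏε)p(Lᵏε)`.  (e) Everything else as in F9's HONEST
SCOPE (value clause only; centred cube `□₁`, `R₁ ⇐ 2r`, `S ⇐ 4r`, depth of `x`, base point the corner, general (2.55) thresholds,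
constants' provenance).  NOT summit progress.
-/

open scoped BigOperators

noncomputable section

namespace Literature.MathematicalPhysics.QuantumFieldTheory.Balaban1983to89.B2Eq265From260

open HiggsLattice (ChargeData)
open HiggsAveraging (blockIter)
open HiggsCovariance (avgQkAdj)
open B2Eq255Concrete (bgScalar256 underRegion mem_underRegion Restr255)
open B2Eq265Restrictions255 (eq265_higgs_region_restr255)
open B2Lemma23HiggsLattice (cutMin lemma23_higgsLattice)
open B1Eq211ZeroFieldTorus (Shape)
open B3MultiscaleFields (toSite ofSite)
open B1Ineq225RegularBox (cellBox)
open B1Ineq234Concrete (distC)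
open B1TorusRegionHSizes (IsBigBlockUnion)
open B1TorusCubeCover (half)
open B1TorusCubeLocality26 (rS)

variable {P : HiggsLattice.Params} {k : ℕ}

/-! ## §1 The gradient hypothesis for `ofSite (cutMin …)` from an `ℝ^d`-norm bound -/

section Gradient

/-- a bond-component difference of `ofSite f` is bounded by the `ℝ^d`-norm difference of `f`: `|f(z′)_μ − f(z)_μ| ≤ ‖f(z′) − f(z)‖`
(part I p.608: vector fields as `ℝ^d`-valued site functions, `N = d`). [cite: Balaban1982Higgs1, p.608] -/
theorem abs_ofSite_sub_le (f : HiggsLattice.ScalarField P 0 P.d) (z z' : HiggsLattice.Site P 0) (μ : Fin P.d) :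
    |ofSite f ⟨z', μ⟩ - ofSite f ⟨z, μ⟩| ≤ ‖f z' - f z‖ := by
  have h : ofSite f ⟨z', μ⟩ - ofSite f ⟨z, μ⟩ = (f z' - f z) μ := by
    simp [ofSite]
  rw [h, ← Real.norm_eq_abs]
  exact PiLp.norm_apply_le (f z' - f z) μ

/-- **F9's small-gradient hypothesis on `Bᵏ(Λ₂)` for `A^{(k)} := ofSite (cutMin …)` from a (2.60)-type bound**: if
`‖A^{(k)}(z + e_ν) − A^{(k)}(z)‖ ≤ g ≤ δA` for every `z` with `z_k ∈ Λ₂` and every `ν`, then `|A_{⟨z+e_ν,μ⟩} − A_{⟨z,μ⟩}| ≤ δA` on `Bᵏ(Λ₂)`.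
[cite: Balaban1982Higgs2, Lemma 2.3 (2.60) p.571]
[cite: Balaban1982Higgs2, Lemma 2.4 proof p.572 «From the property (2.60) we have the inequality |A^{(k)}(x) − A^{(k)}(y)| ≦ O(p(Lᵏε)r(Lᵏε)).»] -/
theorem grad_ofSite_cutMin_le (C₀ : ChargeData P.d) (mu0sq aV : ℝ) (k : ℕ)
    (ζ : HiggsLattice.Site P 0 → HiggsLattice.Site P k → ℝ) (Ak : HiggsLattice.ScalarField P k P.d) (Λ₂ : Finset (HiggsLattice.Site P k))
    {g δA : ℝ} (hg : g ≤ δA)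
    (h60 : ∀ z : HiggsLattice.Site P 0, blockIter k z ∈ Λ₂ → ∀ ν : Fin P.d,
      ‖cutMin C₀ mu0sq aV k ζ Ak (z.shift ν) - cutMin C₀ mu0sq aV k ζ Ak z‖ ≤ g) :
    ∀ z ∈ underRegion k Λ₂, ∀ μ ν : Fin P.d,
      |ofSite (cutMin C₀ mu0sq aV k ζ Ak) ⟨z.shift ν, μ⟩ - ofSite (cutMin C₀ mu0sq aV k ζ Ak) ⟨z, μ⟩| ≤ δA := by
  intro z hz μ ν
  exact ((abs_ofSite_sub_le _ z (z.shift ν) μ).trans (h60 z ((mem_underRegion k Λ₂ z).mp hz) ν)).trans hg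

end Gradient

/-! ## §2 (2.65) with `δA` fed by Lemma 2.3 (2.60) -/

section Eq265From260

/-- **LEMMA 2.4 (2.65), VALUE CLAUSE, ON THE (Higgs)₂,₃ CARRIER — `A^{(k)}` the cut-off minimizer (2.54), its regularity FROM (2.60).**
TYPED vs PRINTED: this is F9's `B2Eq265Restrictions255.eq265_higgs_region_restr255` word for word except the located edits: `hL` is the torus
sub-family's `Odd L ∧ 1 < L`; new leading binders `a_V > 0`, `μ₀² > 0` (constants of the vector-field propagator in (2.54)) and the prefix
`∃ δ C_V C_F > 0` (Lemma 2.3's constants); `∀ P` gains `Shape P`; the block `∀ (A : VecField P 0) {δA}, 0 ≤ δA → (∀ z ∈ Bᵏ(Λ₂), ∀ μ ν,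
|A_{⟨z+e_ν,μ⟩} − A_{⟨z,μ⟩}| ≤ δA) →` is REPLACED by Lemma 2.3's data and hypotheses, verbatim from `lemma23_higgsLattice` — `Λ₋₁ ⊇ Λ₂`
(moved forward from the `φ`-block, whose `Λ₆ ⊆ Λ₋₁` is dropped as derived), `ζ, ρ, ρ₁` with `0 ≤ ρ₁`, `|ζ| ≤ 1`, support radius `ρ`,
plateau `ρ₁`, Lipschitz `L^{−k}`, the neighbourhood condition into `Λ₋₁`, a charge datum `C₀ : ChargeData P.d`, the step's vector field `A′`
with `t_V, q_V, r₁, r₂ ≥ 0`, `‖(toSite A′)(y′)‖ ≤ t_V` on `Λ₋₁`, `‖(toSite A′)(y′) − (toSite A′)(y)‖ ≤ q_V(r₁ + r₂|y − y′|)` for `y ∈ Λ₂`,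
`y′ ∈ Λ₋₁` — followed by `{δA}` with `L^{−k}(C_V(r₁+r₂)q_V + C_F e^{−δρ₁}t_V) ≤ δA`; and `A ↦ ofSite (cutMin C₀ μ₀² a_V k ζ (toSite A′))`
at its three occurrences.  The bound is F9's, character for character. [cite: Balaban1982Higgs2, Lemma 2.4 (2.65) p.572]
[cite: Balaban1982Higgs2, Lemma 2.4 proof p.572 «From the property (2.60) we have the inequality |A^{(k)}(x) − A^{(k)}(y)| ≦ O(p(Lᵏε)r(Lᵏε)).»]
[cite: Balaban1982Higgs2, Lemma 2.3 (2.60) p.571, (2.54) p.569] -/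
theorem eq265_higgs_region_from260 (d L : ℕ) (hd : 1 ≤ d) (hL : Odd L ∧ 1 < L) {a : ℝ} (ha : 0 < a) {msq : ℝ} (hmsq : 0 < msq)
    {aV : ℝ} (haV : 0 < aV) {mu0sq : ℝ} (hmu0 : 0 < mu0sq)
    (N : ℕ) (C : ChargeData N) (ε₀ : ℝ) (creg β : ℝ) (hcreg : 0 ≤ creg) (hβ : 0 < β) :
    ∃ δ CV CF : ℝ, 0 < δ ∧ 0 < CV ∧ 0 < CF ∧
    ∃ K₀min : ℕ, ∀ K₀ : ℕ, K₀min ≤ K₀ → ∃ e₁ t : ℝ, 0 < e₁ ∧ 0 < t ∧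
      ∃ C₁ C₂ C₃ D₁ D₂ D₃ D₄ : ℝ, 0 ≤ C₁ ∧ 0 ≤ C₂ ∧ 0 ≤ C₃ ∧ 0 ≤ D₁ ∧ 0 ≤ D₂ ∧ 0 ≤ D₃ ∧ 0 ≤ D₄ ∧
      ∀ (P : HiggsLattice.Params) (_ : Shape P), P.d = d → P.L = L → K₀ ∣ P.M →
      ∀ {k : ℕ}, 1 ≤ k → k ≤ P.K → (∀ μ, 3 * half P k K₀ ≤ P.sitesPerDir 0 μ) → P.mesh k ≤ ε₀ → P.mesh k ≤ 1 →
      ∀ (Λ₂ Λ₆ sq₂ sq₁ : Finset (HiggsLattice.Site P k)) (S : Fin P.d → Finset ℕ) (q : HiggsLattice.Site P k) (Sbox : ℕ),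
        Λ₆ ⊆ Λ₂ → sq₂ ⊆ Λ₂ → sq₁ ⊆ sq₂ → sq₁ ⊆ Λ₆ →
        IsBigBlockUnion k K₀ (underRegion k Λ₂) → underRegion k sq₂ = cellBox k K₀ S →
        (∀ μ : Fin P.d, P.L ^ k * Sbox < P.sitesPerDir 0 μ) →
      -- `□₂` IS the box `q + [0,S)ᵈ` of coarse sites, `□ = B^k(□₂)` smaller than half the torus
        (∀ y : HiggsLattice.Site P k, y ∈ sq₂ ↔ ∀ ν : Fin P.d, (y ν - q ν).val < Sbox) →
        (∀ μ : Fin P.d, 2 * (P.L ^ k * Sbox) ≤ P.sitesPerDir 0 μ) →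
      -- `□₁` is the box of coarse sites of radius `R₁` about `ȳ` (corner `q₁`), smaller than half the torus
      ∀ (q₁ : HiggsLattice.Site P k) (R₁ : ℕ), (∀ μ : Fin P.d, 2 * (2 * R₁ + 1) ≤ P.sitesPerDir k μ) →
        (∀ y : HiggsLattice.Site P k, y ∈ sq₁ ↔ ∀ ν : Fin P.d, (y ν - q₁ ν).val < 2 * R₁ + 1) →
      -- LEMMA 2.3's DATA: the region `Λ₋₁ ⊇ Λ₂` of (2.55), the cutoff `ζ^{(k)}` of (2.44), the step's vector field `A′` with (2.55)₁,₂ integrated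
      ∀ (Λm1 : Finset (HiggsLattice.Site P k)), Λ₂ ⊆ Λm1 →
      ∀ (ζ : HiggsLattice.Site P 0 → HiggsLattice.Site P k → ℝ) (ρ ρ₁ : ℝ), 0 ≤ ρ₁ →
        (∀ x y', |ζ x y'| ≤ 1) →
        (∀ x y', ζ x y' ≠ 0 → (HiggsLattice.Site.tdist (blockIter k x) y' : ℝ) ≤ ρ) →
        (∀ x y', (HiggsLattice.Site.tdist (blockIter k x) y' : ℝ) ≤ ρ₁ → ζ x y' = 1) →
        (∀ (x : HiggsLattice.Site P 0) (ν : Fin P.d) (y' : HiggsLattice.Site P k), |ζ (x.shift ν) y' - ζ x y'| ≤ ((P.L : ℝ) ^ k)⁻¹) →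
        (∀ x y', blockIter k x ∈ Λ₂ → (HiggsLattice.Site.tdist (blockIter k x) y' : ℝ) ≤ ρ + 1 → y' ∈ Λm1) →
      ∀ (C₀ : ChargeData P.d) (A' : HiggsLattice.VecField P k) (tV qV r₁ r₂ : ℝ), 0 ≤ tV → 0 ≤ qV → 0 ≤ r₁ → 0 ≤ r₂ →
        (∀ y' ∈ Λm1, ‖toSite A' y'‖ ≤ tV) →
        (∀ y ∈ Λ₂, ∀ y' ∈ Λm1, ‖toSite A' y' - toSite A' y‖ ≤ qV * (r₁ + r₂ * (HiggsLattice.Site.tdist y y' : ℝ))) →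
      -- `δA` is at least the (2.60) bound, and small in the two printed scalings
      ∀ {δA : ℝ}, ((P.L : ℝ) ^ k)⁻¹ * (CV * (r₁ + r₂) * qV + CF * Real.exp (-(δ * ρ₁)) * tV) ≤ δA →
          (P.L : ℝ) ^ k * δA * |C.e| ≤ t →
        ∀ {ec : ℝ}, 0 < ec → ec ≤ e₁ → (P.L : ℝ) ^ k * P.mesh k * |C.e| * δA ≤ creg * ec ^ β →
      ∀ (x : HiggsLattice.Site P 0),
        (∀ z, HiggsLattice.Site.tdist x z ≤ 2 * rS P k K₀ + 2 * half P k K₀ * (P.d + 1) + 1 → z ∈ underRegion k sq₂) →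
        (∀ ν : Fin P.d, ((blockIter k x) ν - q₁ ν).val = R₁) →
      -- the restrictions (2.55) on `Λ₋₁` for the fields `A′, φ` of the step and the background `A^{(k)} = a_kζ^{(k)}G_kQ_k^*A′`
      ∀ (φ : HiggsLattice.ScalarField P k N) {c₁ pℓ tA tPhi : ℝ}, 0 ≤ c₁ → 0 ≤ pℓ → 0 ≤ tPhi →
        Restr255 C c₁ pℓ tA tPhi k Λm1 A' φ (ofSite (cutMin C₀ mu0sq aV k ζ (toSite A'))) →
        ‖bgScalar256 C msq a k Λ₂ Λ₆ (ofSite (cutMin C₀ mu0sq aV k ζ (toSite A'))) φ x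
            - avgQkAdj C (ofSite (cutMin C₀ mu0sq aV k ζ (toSite A'))) k φ x‖
          ≤ B1.aSeq a P.L k * (c₁ * tPhi * pℓ) *
                (C₁ * Real.exp (-(1 / (4 * K₀) * (distC (underRegion k sq₂) x / (P.L : ℝ) ^ k)))
                  + C₂ * Real.exp (-(1 / (4 * K₀) * ((R₁ : ℝ) + 1))))
            + (D₁ * P.mesh k ^ 2 *
                (B1.aSeq a P.L k * (P.mesh k)⁻¹ ^ 2 * (|C.e| * (δA * (P.d * ((P.L : ℝ) ^ k * Sbox))) * P.mesh 0 * (P.d * ((P.L : ℝ) ^ k - 1))) * (c₁ * tPhi * pℓ)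
                  + |C.e| * (δA * (P.d * ((P.L : ℝ) ^ k * Sbox))) * (P.d * ((B1.aSeq a P.L k * (P.mesh k)⁻¹ ^ 2 * (c₁ * tPhi * pℓ) * D₄ * P.mesh k
                        + |C.e| * (δA * (P.d * ((P.L : ℝ) ^ k * Sbox))) * (B1.aSeq a P.L k * D₃ * (c₁ * tPhi * pℓ))) + |C.e| * (δA * (P.d * ((P.L : ℝ) ^ k * Sbox))) * (B1.aSeq a P.L k * D₃ * (c₁ * tPhi * pℓ))))
                  + B1.aSeq a P.L k * (P.mesh k)⁻¹ ^ 2 *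
                      ((2 * (|C.e| * (δA * (P.d * ((P.L : ℝ) ^ k * Sbox))) * P.mesh 0 * (P.d * ((P.L : ℝ) ^ k - 1)))
                        + (|C.e| * (δA * (P.d * ((P.L : ℝ) ^ k * Sbox))) * P.mesh 0 * (P.d * ((P.L : ℝ) ^ k - 1))) ^ 2) * (B1.aSeq a P.L k * D₃ * (c₁ * tPhi * pℓ))))
              + D₂ * P.mesh k * (|C.e| * (δA * (P.d * ((P.L : ℝ) ^ k * Sbox))) * (B1.aSeq a P.L k * D₃ * (c₁ * tPhi * pℓ))))
            + B1.aSeq a P.L k * C₃ *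
                (4 * K₀ * ((P.mesh k * (c₁ * pℓ) + P.mesh k * |C.e| * (δA * (P.d * ((P.L : ℝ) ^ k * Sbox))) * (c₁ * tPhi * pℓ)) * P.d)
                  + Real.exp (-(1 / (4 * K₀) * ((R₁ : ℝ) + 1))) * (c₁ * tPhi * pℓ))
            + msq * P.mesh k ^ 2 / (B1.aSeq a P.L k + msq * P.mesh k ^ 2) * (c₁ * tPhi * pℓ)
            + |C.e| * P.mesh 0 * (P.d * ((P.L : ℝ) ^ k - 1)) * (δA * (P.d * ((P.L : ℝ) ^ k * Sbox))) * (c₁ * tPhi * pℓ) := by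
  -- Lemma 2.3's constants (vector-field case `N = d`), then F9's
  obtain ⟨δ, CV, CF, hδ, hCV, hCF, h23⟩ := lemma23_higgsLattice d L d hd hL haV hmu0 ε₀
  have hL2 : 2 ≤ L := by omega
  obtain ⟨K₀min, h⟩ := eq265_higgs_region_restr255 d L hd hL2 ha hmsq N C ε₀ creg β hcreg hβ
  refine ⟨δ, CV, CF, hδ, hCV, hCF, K₀min, fun K₀ hK₀ => ?_⟩
  obtain ⟨e₁, t, he₁, ht, C₁, C₂, C₃, D₁, D₂, D₃, D₄, hC₁, hC₂, hC₃, hD₁, hD₂, hD₃, hD₄, h⟩ := h K₀ hK₀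
  refine ⟨e₁, t, he₁, ht, C₁, C₂, C₃, D₁, D₂, D₃, D₄, hC₁, hC₂, hC₃, hD₁, hD₂, hD₃, hD₄, ?_⟩
  intro P S hPd hPL hK₀M k hk1 hkK h3 hε h1 Λ₂ Λ₆ sq₂ sq₁ Sfin q Sbox h62 hs2 h12 h16 hΩΛ hbox hSbox hsq₂ h2S q₁ R₁ hS₁ hsq₁
    Λm1 h2m1 ζ ρ ρ₁ hρ₁ zeta_abs zeta_supp zeta_one zeta_lip nbhd C₀ A' tV qV r₁ r₂ htV hqV hr₁ hr₂ hA_abs hA_var δA h60δ ht' ec hec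
    hle hsmall x hx hcentre φ c₁ pℓ tA tPhi hc₁ hpℓ htPhi h255
  -- (2.60) for the cut-off minimizer, by name
  have hgrad : ∀ z ∈ underRegion k Λ₂, ∀ μ ν : Fin P.d,
      |ofSite (cutMin C₀ mu0sq aV k ζ (toSite A')) ⟨z.shift ν, μ⟩ - ofSite (cutMin C₀ mu0sq aV k ζ (toSite A')) ⟨z, μ⟩| ≤ δA := by
    subst hPd
    refine grad_ofSite_cutMin_le C₀ mu0sq aV k ζ (toSite A') Λ₂ h60δ ?_
    intro z hz ν
    exact (h23 P S rfl hPL C₀ hk1 hkK hε ζ ρ ρ₁ hρ₁ zeta_abs zeta_supp zeta_one zeta_lip Λm1 Λ₂ h2m1 nbhd (toSite A') tV qV r₁ r₂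
      hqV hr₁ hr₂ hA_abs hA_var z hz).2 ν
  -- `0 ≤ δA`
  have hδA : 0 ≤ δA := by
    refine le_trans ?_ h60δ
    have h1 : 0 ≤ CV * (r₁ + r₂) * qV := by positivity
    have h2 : 0 ≤ CF * Real.exp (-(δ * ρ₁)) * tV := by positivity
    have h3 : 0 ≤ ((P.L : ℝ) ^ k)⁻¹ := inv_nonneg.mpr (pow_nonneg (Nat.cast_nonneg _) k)
    exact mul_nonneg h3 (add_nonneg h1 h2)
  exact h P hPd hPL hK₀M hk1 hkK h3 hε h1 Λ₂ Λ₆ sq₂ sq₁ Sfin q Sbox h62 hs2 h12 h16 hΩΛ hbox hSbox hsq₂ h2S q₁ R₁ hS₁ hsq₁ _ hδA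
    hgrad ht' hec hle hsmall x hx hcentre φ Λm1 A' hc₁ hpℓ htPhi (h62.trans h2m1) h255

end Eq265From260

end Literature.MathematicalPhysics.QuantumFieldTheory.Balaban1983to89.B2Eq265From260

end
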